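import Summits.Schanuel.Schanuel.Theorems.RootDecomp1KDegreeLadder05

/-!
# RootDecomp1KDegreeLadder — lens 1, generation 45 «DEGREE LADDER AT FIXED SKEL-QUALITY (DL) + THIN-FIBRE RESIDUAL» (lane K-R30 (b); CLAIM L2155, ACK/CHECKLIST K-g45 L2159, NODE L2213 / REQUEST L2214, writer re-checks L2219/L2221/L2230, critic VERDICT L2216: CLEARED — THEOREM ×1 for DL `degreeLadder`; EDITION 2/3 docstring-only accepted L2224 / files of record L2228 (K ed. 3 f2af863f…); RULE K-R31; lens-1 tally credits ×11 + THEOREM ×2) — continuation (RootDecomp1KDegreeLadder06): §5d ThinFibre residual + §6 toy fibre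

(lens-1 g45 HOME kernel K = HOME/decomp-schanuel-lens-1/g45/DegreeLadder.lean EDITION 3 f2af863f…, 2183 l, imports tree `…RootDecomp1KSkelCell01` (the tree now has `…SkelCell10` with §8's `SkelLiouvilleFix`); P DLprobe.lean f44a49e4… rc 0, C DLctrl.lean 394594cd… rc 1 = exactly the 13 planted errors. Port by census-1 gen 19 as `RootDecomp1KDegreeLadder01`–`08` (+ `09` deferred): 01 = K's module doc + §0 residue (`skelLiouvilleFix_of_skelLiouville`, `SkelLiouvilleFix.liouville` / `.transcendental` declared in the TREE namespace `…RootDecomp1KSkelCell` so dot-notation keeps working) + §1 toolkit `bev`/`xdeg`/`dX`/`specX`; 02 = §2 truncations + §3 calculus (`tangent`, Lipschitz, `coeff_specX_bound`); 03 = §4 engine A (`onCurve_exponent_ineq`, `engine_core`); 04 = §4 engine B (`lowDegree_clause`, `engine_of_clause`, `engine`) + §5 THE DEGREE LADDER `degreeLadder (d) (ρ) (hρ : SkelLiouvilleFix (d + 1) ρ) (P : ℤ[X][X]) (hP : P ≠ 0) (hdeg : P.natDegree ≤ d) : bev P (liouvilleNumber 2) ρ ≠ 0` (descent `no_relation_of_engine`);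 05 = §5b limit corollary (`algebraicIndependent_of_forall_fix`) + §5c relative degree (`relDegree_gt`, `skelFix_two_not_mem_adjoin(_complex)`); 06 = §5d the residual `ThinFibre`/`ThinFibreAt` (+ glue `thinFibre_imp_b`) + §6 the toy fibre decided (`sq_fibre_iff`, `toy_clause`); 07 = §7 tightness at d = 1 (`degreeLadder_tight_one`, `rU_injective`, `not_thinFibre_one`, `not_thinFibre_zero`); 08 = §8a the 2-adic mechanism (`two_adic_split`, `two_adic_quality`, hypothesis-free); 09 (DEFERRED until Literature `…DiophantineApproximation.RidoutIntegers` builds on the check farm, rc 75 today) = §8b `isSquare_mul_psNumer_finite`, `isSquare_seventeen_mul_psNumer_finite`, `thinFibreAt_sqMulP` with `Ridout.padicRoth_int` BY NAME (K carries them under a `(hR : PadicRothInt)` binder whose `def` is NOT landed — verdict condition (c)).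
PORT EDITS: import `…SkelCell10` instead of `…SkelCell01` and DELETE K's verbatim copies of the tree's §8 (`SkelLiouvilleFix`, `skelLiouville_iff_fix`, `SkelLiouvilleFix.mono`, `uStar`, `dU`, `rU`, `dU_cast`, `two_pow_le_four_mul_dU`, `two_mul_dU_lt`, `one_le_dU`, `rU_den`, `rU_cast`, `uStar_sub_rU`, `skelLiouvilleFix_one_uStar`, `not_skelFixOne_algebraicIndependent` — 15 blocks, opened from `…RootDecomp1KSkelCell` by name; verdict condition (a)); the file-wide linter option dropped (b); 58 one-line docstrings added to undocumented helper lemmas; 34 small generic ℓ₂/`psNumer`/`partialSum`/cast lemmas made PRIVATE (dedup-safety against tree twins in TwoBaseCell/CommonRadixCell/SkelCell/RadixCell) with per-part private copies; `ThinFibre`/`ThinFibreAt` docstrings carry the residual-class tag (d); graded statements and proofs otherwise verbatim. `--supports stmt-Schanuel-33364`; no census credit carried; rung 0 — nothing here proves Schanuel, `FiniteOrderLiouvilleSchanuel` (33364), `CoordLiouvilleSchanuel` (31077) or (b) at fixed quality.)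
-/

noncomputable section

open Polynomial LiouvilleNumber
open scoped Nat

namespace Summit.Schanuel.Schanuel.Theorems.RootDecomp1KDegreeLadder

open Summit.Schanuel.Schanuel.Theorems.RootDecomp1KSkelCell
  (exists_le_two_pow_factorial iota iota_spec iota_le_of_le pow_lt_of_lt_iota lt_iota_of_pow_lt iota_mono
   one_le_iota SkelLiouville SkelLiouvilleFix skelLiouville_iff_fix SkelLiouvilleFix.mono uStar dU rU dU_cast
   two_pow_le_four_mul_dU two_mul_dU_lt one_le_dU rU_den rU_cast uStar_sub_rU skelLiouvilleFix_one_uStar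
   not_skelFixOne_algebraicIndependent)
open Summit.Schanuel.Schanuel.Theorems.RootDecomp1KTwoBaseCell (psNumer partialSum_eq_psNumer_div coprime_psNumer
  algebraicIndependent_of_forall_int')
open Summit.Schanuel.Schanuel.Theorems.RootDecomp1KRelLiouvilleCell (partialSum_two_strictMono
  partialSum_two_lt_liouvilleNumber abs_liouvilleNumber_two_sub_partialSum)

/-- `ℓ₂ := liouvilleNumber 2`. -/
private theorem ell2_eq (N : ℕ) : liouvilleNumber 2 = partialSum 2 N + remainder 2 N :=
  (partialSum_add_remainder (by norm_num) N).symm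

/-- `s_N = p_N / 2^{N!}` (tree `partialSum_eq_psNumer_div` at `b = 2`). -/
private theorem partialSum_two (N : ℕ) : partialSum 2 N = (psNumer 2 N : ℝ) / (2 : ℝ) ^ N ! := by
  have := partialSum_eq_psNumer_div (b := 2) (by norm_num) N
  simpa using this

/-- `1/2^{(N+1)!} ≤ ℓ₂ − s_N < 2/2^{(N+1)!}`. -/
private theorem remainder_two_lt (N : ℕ) : remainder 2 N < 2 / (2 : ℝ) ^ (N + 1)! := by
  have h := remainder_lt' N (m := (2 : ℝ)) (by norm_num)
  have e : (1 - 1 / (2 : ℝ))⁻¹ * (1 / 2 ^ (N + 1)!) = 2 / (2 : ℝ) ^ (N + 1)! := by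
    rw [div_eq_mul_inv (2 : ℝ) (2 ^ (N + 1)!), one_div]
    norm_num
  linarith [h, e]

/-- `ℓ₂ < 3/2`. -/
private theorem ell2_lt_three_halves : liouvilleNumber 2 < 3 / 2 := by
  rw [ell2_eq 0]
  have h1 : partialSum 2 0 = 1 / 2 := by simp [partialSum]
  have h2 := remainder_two_lt 0
  norm_num [Nat.factorial] at h2
  linarith

/-! ## §5d  The residual at FIXED quality: the THIN-FIBRE statement and its glue to (b) -/

section ThinFibre

/-- [residual class] statement def (census convention, VERDICT L2216 (d)): the route's residual at FIXED quality — OPEN for `m₀ ≥ 2` (leaf IDEA-NEEDED of record, K-R31 (ii)/(iv), reach sentence L2224/L2228); `ThinFibre 1`, `ThinFibre 0` REFUTED below (`not_thinFibre_one`, `not_thinFibre_zero`); glue to (b) = `thinFibre_imp_b`. **RESIDUAL «THIN FIBRE at Skel-quality `m₀`»** (UNDECIDED for `m₀ ≥ 2`; FALSE for `m₀ ≤ 1`).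
For every non-zero `P ∈ ℤ[X][Y]` and every constant `C`: beyond some level `N₀`, every rational point `r` with
`|r| ≤ C` ON a level curve `P(s_N, ·) = 0` (`s_N = psNumer 2 N / 2^{N!}` the `N`-th truncation of `ℓ₂`, `N ≥ N₀`)
that is NON-DEGENERATE (`P(x, r) ≠ 0` for some `x`, i.e. `r` is not a `Y`-root of `P` identically in `x`) has a
LARGE denominator: `den(r)^{m₀·N} > C·2^{(N+1)!}`.  Both provisos are forced by trivial witnesses — without
«beyond some level» take `P = (4x − 5)·Y` (its level-`2` curve is the whole line, `s₂ = 5/4`), without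
«non-degenerate» take `P = Y − 3` (the point `r = 3` above every level) —, and what remains is Diophantine:
by Gauss a non-degenerate point above level `N` has `den(r) ≳ 2^{N!/deg_Y P}` so the clause HOLDS for every
curve of `Y`-degree `< m₀` (`lowDegree_clause`, PROVED — this is the on-curve half of the ladder), and a failure
needs SPORADIC rational points of height `≈ 2^{N!/m₀}` on curves of `Y`-degree `≥ m₀` at infinitely many levels,
e.g. for `P = Y² − 17x`, `m₀ = 2`: «`17·psNumer 2 N` is a perfect square for infinitely many `N`» — and THAT instance
is excluded in §8 (`isSquare_seventeen_mul_psNumer_finite`, 2-adically via Ridout: `p_N → 1` in `ℤ₂`), so the open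
question is the clause for curves outside the family `Y² = c·x`.
`ThinFibre 1` is FALSE (`not_thinFibre_one`: the line `(x − 1)·Y = 1` through `u⋆`); the `x`-only toy
`Y² = x` satisfies the clause at every `m₀` (`toy_clause`, from `sq_fibre_iff`). -/
def ThinFibre (m₀ : ℕ) : Prop :=
  ∀ P : ℤ[X][X], P ≠ 0 → ∀ C : ℝ, ∃ N₀ : ℕ, ∀ N : ℕ, N₀ ≤ N → ∀ r : ℚ, |(r : ℝ)| ≤ C →
    bev P (partialSum 2 N) r = 0 → (∃ x : ℝ, bev P x r ≠ 0) →
      C * 2 ^ (N + 1)! < (r.den : ℝ) ^ (m₀ * N)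

/-- [residual class] statement def (census convention): the clause of `ThinFibre m₀` for ONE polynomial `P` (decided hypothesis-free for the toy conic `toyP` — `toy_clause` — and, modulo the tree's Ridout theorem, for the conics `sqMulP c`, deferred part 09). -/
def ThinFibreAt (m₀ : ℕ) (P : ℤ[X][X]) : Prop :=
  ∀ C : ℝ, ∃ N₀ : ℕ, ∀ N : ℕ, N₀ ≤ N → ∀ r : ℚ, |(r : ℝ)| ≤ C →
    bev P (partialSum 2 N) r = 0 → (∃ x : ℝ, bev P x r ≠ 0) →
      C * 2 ^ (N + 1)! < (r.den : ℝ) ^ (m₀ * N)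

/-- `ThinFibre m₀` unfolded curve by curve. -/
theorem thinFibre_iff_forall_at (m₀ : ℕ) : ThinFibre m₀ ↔ ∀ P : ℤ[X][X], P ≠ 0 → ThinFibreAt m₀ P :=
  Iff.rfl

/-- LOW DEGREE IS FREE: the clause holds for every `P` of `Y`-degree `< m₀` (the Gauss half of the ladder). -/
theorem thinFibreAt_of_natDegree_lt {m₀ : ℕ} {P : ℤ[X][X]} (h : P.natDegree < m₀) : ThinFibreAt m₀ P :=
  fun C => lowDegree_clause h C

/-- Hence `ThinFibre m₀` reduces to the curves of `Y`-degree `≥ m₀`. -/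
theorem thinFibre_iff_high (m₀ : ℕ) :
    ThinFibre m₀ ↔ ∀ P : ℤ[X][X], P ≠ 0 → m₀ ≤ P.natDegree → ThinFibreAt m₀ P := by
  refine ⟨fun h P hP _ => h P hP, fun h P hP => ?_⟩
  by_cases hlt : P.natDegree < m₀
  · exact thinFibreAt_of_natDegree_lt hlt
  · exact h P hP (not_lt.mp hlt)

/-- Monotonicity in the quality: `ThinFibre m₀ → ThinFibre m₀'` for `m₀ ≤ m₀'` (`den ≥ 1`). -/
theorem ThinFibre.mono {m₀ m₀' : ℕ} (h : m₀ ≤ m₀') (hTF : ThinFibre m₀) : ThinFibre m₀' := by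
  intro P hP C
  obtain ⟨N₀, hN₀⟩ := hTF P hP C
  refine ⟨N₀, fun N hN r hrC hA hx => ?_⟩
  have h1 := hN₀ N hN r hrC hA hx
  have hq : (1 : ℝ) ≤ r.den := by exact_mod_cast r.den_pos
  exact h1.trans_le (pow_le_pow_right₀ hq (Nat.mul_le_mul_right _ h))

/-- the thin-fibre engine: `engine_of_clause` fed with the clause of `ThinFibre m` for this `P` —
for EVERY `Y`-degree (no `m = d + 1`). -/
theorem engine_thin {P : ℤ[X][X]} {ρ : ℝ} {m : ℕ} (hm : 1 ≤ m) (hTF : ThinFibre m) (hP : P ≠ 0)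
    (hd : 1 ≤ P.natDegree) (hroot : bev P (liouvilleNumber 2) ρ = 0)
    (hτ : bev (dX P) (liouvilleNumber 2) ρ ≠ 0) (hρ : SkelLiouvilleFix m ρ) : False :=
  engine_of_clause hm hd hroot hτ hρ (hTF P hP)

/-- **THE GLUE `ThinFibre m₀ ⇒ (b)`** (PROVED, `m₀ ≥ 1`): thin fibres at quality `m₀` give the algebraic
independence of `(ℓ₂, ρ)` for EVERY `ρ ∈ Skel₍m₀₎` — the fixed-quality statement (b) that DL approximates
degree by degree.  (`ThinFibre` is NOT (b) in costume: it speaks of rational points on the level curves only —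
no `ρ`, no Skel class —, is false at `m₀ = 1` where (b) is false (`uStar`), holds for free in `Y`-degree
`< m₀` (`thinFibreAt_of_natDegree_lt`), and per `P` and level it is a decidable statement about the rational
points of one curve.) -/
theorem thinFibre_imp_b {m₀ : ℕ} (hm : 1 ≤ m₀) (hTF : ThinFibre m₀) (ρ : ℝ)
    (hρ : SkelLiouvilleFix m₀ ρ) :
    AlgebraicIndependent ℚ ![((liouvilleNumber 2 : ℝ) : ℂ), (ρ : ℂ)] :=
  algebraicIndependent_of_no_relation fun P hP =>
    no_relation_of_engine (d := P.natDegree) (hρ.transcendental hm)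
      (fun _ hQ0 hd1 _ hroot hτ => engine_thin hm hTF hQ0 hd1 hroot hτ hρ) P hP le_rfl

end ThinFibre

/-! ## §6  THE TOY FIBRE `y² = x` — DECIDED: the square truncations of `ℓ₂` are exactly `s₁ = 1`, `s₃ = (9/8)²`

The cheapest instance of the thin-fibre question: on the curve `y² = x` a rational point above the level
`x = s_N = p_N/2^{N!}` exists iff `s_N` is a rational square.  TRUTH (all `N`, proved below): iff `N = 1` or
`N = 3` (`s₀ = 1/2`, `s₁ = 1`, `s₂ = 5/4`, `s₃ = 81/64 = (9/8)²`, and for `N ≥ 4` the numerator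
`p_N = 2^{N!−(N−1)!}·p_{N−1} + 1` is an odd number `≡ 1 (mod 2^e)` with `e = N! − (N−1)!` so large against
`p_{N−1} < 2·2^{(N−1)!}` that `p_N` cannot be a square: `m² − 1 = (m−1)(m+1) = 2^e p_{N−1}` forces
`p_{N−1} ≥ 2^{e−2} − 1`).  NOTE for the record: the critic's draft `sq_fibre_iff … ↔ N = 3` (CHECKLIST K-g45 (6))
is FALSE as literally written — `s₁ = 1 = 1²` is also a square; the statement proved is `↔ N = 1 ∨ N = 3`.
Consequence `toy_branch_contributes_nothing`: the ON-CURVE branch of the engine on the toy curve is the finite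
set `{±1, ±9/8}` — `ThinFibre`'s clause holds for `P = Y² − x` at EVERY quality `m₀` (even `m₀ = 0`). -/
section Toy

/-- `bev` respects subtraction. -/
@[simp] theorem bev_sub (P Q : ℤ[X][X]) (x y : ℝ) : bev (P - Q) x y = bev P x y - bev Q x y := by
  simp [bev, Polynomial.map_sub, eval_sub]

/-- `bev` respects powers. -/
@[simp] theorem bev_pow (P : ℤ[X][X]) (n : ℕ) (x y : ℝ) : bev (P ^ n) x y = bev P x y ^ n := by
  simp [bev, Polynomial.map_pow, eval_pow]

/-- `bev 1 = 1`. -/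
@[simp] theorem bev_one (x y : ℝ) : bev 1 x y = 1 := by
  simp [bev]

/-- `bev` respects negation. -/
@[simp] theorem bev_neg (P : ℤ[X][X]) (x y : ℝ) : bev (-P) x y = -bev P x y := by
  simp [bev, Polynomial.map_neg]

/-- The numerator recurrence `p_{N+1} = b^{(N+1)!−N!}·p_N + 1`. -/
theorem psNumer_succ (b N : ℕ) : psNumer b (N + 1) = b ^ ((N + 1)! - N !) * psNumer b N + 1 := by
  unfold psNumer
  rw [Finset.sum_range_succ, Nat.sub_self, pow_zero, Finset.mul_sum]
  congr 1
  refine Finset.sum_congr rfl fun i hi => ?_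
  have hi' := Finset.mem_range.mp hi
  have h1 : i ! ≤ N ! := Nat.factorial_le (by omega)
  have h2 : N ! ≤ (N + 1)! := Nat.factorial_le (by omega)
  rw [← pow_add]
  congr 1
  omega

/-- `p_0 = 1`. -/
private theorem psNumer_two_zero : psNumer 2 0 = 1 := by
  simp [psNumer]

/-- `p_1 = 2`. -/
private theorem psNumer_two_one : psNumer 2 1 = 2 := by
  simp [psNumer, Finset.sum_range_succ]

/-- `p_2 = 5`. -/
private theorem psNumer_two_two : psNumer 2 2 = 5 := by
  simp [psNumer, Finset.sum_range_succ, Nat.factorial]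

/-- `p_3 = 81`. -/
private theorem psNumer_two_three : psNumer 2 3 = 81 := by
  simp [psNumer, Finset.sum_range_succ, Nat.factorial]

/-- `0 < p_N`. -/
private theorem psNumer_pos (N : ℕ) : 0 < psNumer 2 N := by
  unfold psNumer
  exact Finset.sum_pos (fun i _ => pow_pos two_pos _) (Finset.nonempty_range_iff.mpr (Nat.succ_ne_zero N))

/-- `p_N < 2·2^{N!}` (`s_N < ℓ₂ < 3/2`). -/
theorem psNumer_lt (N : ℕ) : psNumer 2 N < 2 * 2 ^ N ! := by
  have h := partialSum_two N
  have hs : partialSum 2 N < 3 / 2 := (partialSum_two_lt_liouvilleNumber N).trans ell2_lt_three_halves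
  have hpos : (0 : ℝ) < 2 ^ N ! := by positivity
  rw [h, div_lt_iff₀ hpos] at hs
  have : (psNumer 2 N : ℝ) < 2 * 2 ^ N ! := by linarith
  exact_mod_cast this

/-- The 2-adic square obstruction: no `m² = 2^e·c + 1` with `0 < c`, `c + 1 < 2^{e−2}` (`e ≥ 2`).
(`m = 2t+1`, `t(t+1) = 2^{e−2} c`, the odd one of `t`, `t+1` is prime to `2^{e−2}`, so `2^{e−2}` divides
the other, forcing `c ≥ 2^{e−2} − 1`.) -/
theorem no_odd_square_near (e c m : ℕ) (he : 2 ≤ e) (hc0 : 0 < c) (hc : c + 1 < 2 ^ (e - 2))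
    (h : m ^ 2 = 2 ^ e * c + 1) : False := by
  obtain ⟨e', rfl⟩ : ∃ e', e = e' + 2 := ⟨e - 2, by omega⟩
  rw [Nat.add_sub_cancel] at hc
  set K : ℕ := 2 ^ e' with hK
  have hK0 : 0 < K := pow_pos two_pos e'
  have hpow : 2 ^ (e' + 2) = 4 * K := by rw [hK, pow_add]; ring
  have hodd2 : Odd (m ^ 2) := ⟨2 * K * c, by rw [h, hpow]; ring⟩
  have hoddm : Odd m := by
    have : Odd (m * m) := by rw [← pow_two]; exact hodd2
    exact (Nat.odd_mul.mp this).1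
  obtain ⟨t, rfl⟩ := hoddm
  have ht : t * (t + 1) = K * c := by
    have e1 : (2 * t + 1) ^ 2 = 4 * (t * (t + 1)) + 1 := by ring
    rw [e1, hpow] at h
    rw [mul_assoc] at h
    omega
  have hdvd : K ∣ t * (t + 1) := ⟨c, ht⟩
  rcases Nat.even_or_odd t with hte | hto
  · -- `t` even: `t + 1` odd, so `K ∣ t`, `t = K s`, `c = s (K s + 1) ≥ K + 1`
    have hcop : Nat.Coprime K (t + 1) := by
      rw [hK]; exact Nat.Coprime.pow_left e' (Nat.coprime_two_left.mpr hte.add_one)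
    obtain ⟨s, hs⟩ := hcop.dvd_of_dvd_mul_right hdvd
    have hs1 : 0 < s := by
      rcases Nat.eq_zero_or_pos s with h0 | h0
      · exfalso
        rw [h0, mul_zero] at hs
        rw [hs] at ht
        simp at ht
        rcases ht with ht | ht
        · omega
        · omega
      · exact h0
    have hcs : c = s * (K * s + 1) := by
      apply Nat.eq_of_mul_eq_mul_left hK0
      rw [← ht, hs]; ring
    have h1 : K ≤ K * s := Nat.le_mul_of_pos_right K hs1
    have h2 : K * s + 1 ≤ s * (K * s + 1) := Nat.le_mul_of_pos_left _ hs1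
    omega
  · -- `t` odd: `K ∣ t + 1`, `t + 1 = K s`, `c = t s ≥ t ≥ K − 1`
    have hcop : Nat.Coprime K t := by
      rw [hK]; exact Nat.Coprime.pow_left e' (Nat.coprime_two_left.mpr hto)
    obtain ⟨s, hs⟩ := hcop.dvd_of_dvd_mul_left hdvd
    have hs1 : 0 < s := by
      rcases Nat.eq_zero_or_pos s with h0 | h0
      · rw [h0, mul_zero] at hs; omega
      · exact h0
    have hcs : c = t * s := by
      apply Nat.eq_of_mul_eq_mul_left hK0
      rw [← ht, hs]; ring
    have h1 : K ≤ K * s := Nat.le_mul_of_pos_right K hs1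
    have h2 : t ≤ t * s := Nat.le_mul_of_pos_right t hs1
    omega

/-- **TOY FIBRE, DECIDED.**  `s_N = p_N / 2^{N!}` is the square of a rational iff `N = 1` or `N = 3`. -/
theorem sq_fibre_iff (N : ℕ) :
    (∃ a : ℚ, a ^ 2 = (psNumer 2 N : ℚ) / 2 ^ N !) ↔ (N = 1 ∨ N = 3) := by
  constructor
  · rintro ⟨a, ha⟩
    rcases Nat.lt_or_ge N 2 with hN | hN
    · interval_cases N
      · exfalso
        rw [psNumer_two_zero] at ha
        norm_num [Nat.factorial] at ha
        have h2 : IsSquare ((2 : ℕ) : ℚ) := ⟨2 * a, by push_cast; linear_combination (-4 : ℚ) * ha⟩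
        rw [Rat.isSquare_natCast_iff] at h2
        obtain ⟨r, hr⟩ := h2
        exact Nat.not_exists_sq (m := 1) (by norm_num) (by norm_num) ⟨r, hr.symm⟩
      · exact Or.inl rfl
    · have h2dvd : 2 ∣ N ! := Nat.dvd_factorial two_pos hN
      obtain ⟨k, hk⟩ := h2dvd
      have hsq : IsSquare ((psNumer 2 N : ℕ) : ℚ) := by
        refine ⟨a * 2 ^ k, ?_⟩
        have hne : (2 : ℚ) ^ N ! ≠ 0 := pow_ne_zero _ two_ne_zero
        have h2k : (2 : ℚ) ^ N ! = 2 ^ k * 2 ^ k := by rw [hk, two_mul, pow_add]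
        have e1 : ((psNumer 2 N : ℕ) : ℚ) = a ^ 2 * 2 ^ N ! := by
          rw [ha]; field_simp
        rw [e1, h2k]; ring
      rw [Rat.isSquare_natCast_iff] at hsq
      obtain ⟨m, hm⟩ := hsq
      rcases (show N = 2 ∨ N = 3 ∨ 4 ≤ N by omega) with rfl | rfl | hN4
      · exfalso
        rw [psNumer_two_two] at hm
        exact Nat.not_exists_sq (m := 2) (by norm_num) (by norm_num) ⟨m, hm.symm⟩
      · exact Or.inr rfl
      · exfalso
        obtain ⟨M, rfl⟩ : ∃ M, N = M + 1 := ⟨N - 1, by omega⟩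
        have hM : 3 ≤ M := by omega
        rw [psNumer_succ] at hm
        have hF6 : 6 ≤ M ! := (Nat.factorial_le hM : 3 ! ≤ M !)
        have hfs : (M + 1)! = (M + 1) * M ! := Nat.factorial_succ M
        have h3F : 3 * M ! ≤ M * M ! := Nat.mul_le_mul_right _ hM
        have he' : (M + 1)! - M ! = M * M ! := by rw [hfs, Nat.succ_mul]; omega
        have he2 : M ! + 4 ≤ ((M + 1)! - M !) - 2 := by rw [he']; omega
        have hc : psNumer 2 M + 1 < 2 ^ (((M + 1)! - M !) - 2) := by
          have h1 := psNumer_lt M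
          have h2 : 2 ^ (M ! + 4) ≤ 2 ^ (((M + 1)! - M !) - 2) := Nat.pow_le_pow_right two_pos he2
          have h3 : 2 ^ (M ! + 4) = 16 * 2 ^ M ! := by rw [pow_add]; ring
          omega
        exact no_odd_square_near ((M + 1)! - M !) (psNumer 2 M) m (by rw [he']; omega) (psNumer_pos M)
          hc (by rw [sq]; exact hm.symm)
  · rintro (rfl | rfl)
    · exact ⟨1, by rw [psNumer_two_one]; norm_num [Nat.factorial]⟩
    · exact ⟨9 / 8, by rw [psNumer_two_three]; norm_num [Nat.factorial]⟩

/-- The toy curve `y² = x` as `P = Y² − x ∈ ℤ[x][Y]`. -/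
def toyP : ℤ[X][X] := X ^ 2 - C X

/-- `toyP(x, y) = y² − x`. -/
@[simp] theorem bev_toyP (x y : ℝ) : bev toyP x y = y ^ 2 - x := by
  simp [toyP]

/-- `toyP ≠ 0`. -/
theorem toyP_ne_zero : toyP ≠ 0 := by
  intro h
  have := congrArg (fun P : ℤ[X][X] => P.coeff 2) h
  simp [toyP] at this

/-- **THE TOY BRANCH CONTRIBUTES NOTHING.**  For the curve `y² = x` the on-curve set above the levels
`x = s_N` is contained in `{1, −1, 9/8, −9/8}`; in particular `ThinFibre`'s finiteness clause holds for
`P = Y² − x` at EVERY quality `m₀` and every constant `C`. -/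
theorem toy_branch_contributes_nothing (m₀ : ℕ) (C₀ : ℝ) :
    Set.Finite {r : ℚ | ∃ N : ℕ, bev toyP (partialSum 2 N) r = 0 ∧
      (r.den : ℝ) ^ (m₀ * N) ≤ C₀ * 2 ^ (N + 1)!} := by
  have hfin : Set.Finite ({1, -1, 9 / 8, -(9 / 8)} : Set ℚ) :=
    (((Set.finite_singleton _).insert _).insert _).insert _
  refine hfin.subset ?_
  rintro r ⟨N, hN, -⟩
  rw [bev_toyP, sub_eq_zero, partialSum_two] at hN
  have hQ : (r : ℚ) ^ 2 = (psNumer 2 N : ℚ) / 2 ^ N ! := by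
    have : ((r ^ 2 : ℚ) : ℝ) = (((psNumer 2 N : ℚ) / 2 ^ N ! : ℚ) : ℝ) := by
      push_cast; exact hN
    exact_mod_cast this
  have hN13 := (sq_fibre_iff N).mp ⟨r, hQ⟩
  rcases hN13 with rfl | rfl
  · rw [psNumer_two_one] at hQ
    norm_num [Nat.factorial] at hQ
    rcases hQ with rfl | rfl <;> simp
  · rw [psNumer_two_three] at hQ
    norm_num [Nat.factorial] at hQ
    have h1 : (r - 9 / 8) * (r + 9 / 8) = 0 := by linear_combination hQ
    rcases mul_eq_zero.mp h1 with h | h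
    · right; right; left; linarith
    · right; right; right
      show r = -(9 / 8)
      linarith

/-- … and in the clause form of `ThinFibre`: for `P = Y² − x` the clause holds at EVERY quality `m₀`
(vacuously beyond level `4`, by `sq_fibre_iff`). -/
theorem toy_clause (m₀ : ℕ) : ThinFibreAt m₀ toyP := by
  intro C
  refine ⟨4, fun N hN r _ hr _ => ?_⟩
  exfalso
  rw [bev_toyP, sub_eq_zero, partialSum_two] at hr
  have hQ : (r : ℚ) ^ 2 = (psNumer 2 N : ℚ) / 2 ^ N ! := by
    have : ((r ^ 2 : ℚ) : ℝ) = (((psNumer 2 N : ℚ) / 2 ^ N ! : ℚ) : ℝ) := by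
      push_cast; exact hr
    exact_mod_cast this
  rcases (sq_fibre_iff N).mp ⟨r, hQ⟩ with rfl | rfl <;> omega

end Toy

end Summit.Schanuel.Schanuel.Theorems.RootDecomp1KDegreeLadder

end
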